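import Summits.QuantumFields.YangMills.Theorems.BalabanUVNodesN19LawPriceAtScheme
import Summits.QuantumFields.YangMills.Theorems.BalabanUVNodesN19LawPriceTwoSided

/-!
# YM-DAG node N19 (= NE7 proper) — THE LAW-LEVEL PRICE AT THE SCHEME, II: g9's continuum law converges at the RATE `log(e+L_K)∕(1+L_K)`

Cell `pub-ymgap`, HUMAN RULING D-0062 (Track A), R141 (C) wider-strategy seat `pub-ymgap-dag-n19-e` (strategy s3 = ALTERNATIVE CURRENCY), generation
g18, module 4.  Route `Summits/QuantumFields/YangMills/Theses/BalabanUVNodes.lean` rev 25, cluster item K3⁷ «SpineGivenEndpointR13SepCoPH»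
(stmt-QuantumFields-20544, dag-lead WORDS-143); filed `--supports` that item `--as helper` (it proves no registered stub).  COUNT-NEUTRAL: bookkeeping over
the seat's p555512 `…N19LawPriceTwoSided` (`law_price_le_logRate`, `abs_integral_le_of_Icc_symm`) and p551618 `…N19LawPriceAtScheme` (`map_prodObs_Icc_compl`,
`cgf_map_prodObs`) BY NAME, with the tree's `T4CauchySum.abs_genFun_sub_lim_le`, p505344 `genFunLim_eq_cgf_of_continuumLaw` ∕ `continuumLaw_of_target`;
N19's DECL target `Spine.NE7.Target` enters as a HYPOTHESIS; no Theses import; NOT a discharge claim.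

THE RESULT.  p551618 made g9's continuum LAW quantitative on the Bernstein road (`2Kg∕√n + Gb·(3A_K)ⁿ·n!·2τ_K e^{2l₀}`, whence only «∀η ∃K₀»).  On the
Jackson road of p554543 ∕ p555512 the rate is explicit and sharp in order: under `Spine.NE7.Target vol l₀ δ (schemeZ S os)` on a window `0 < l₀`, with
`ν` the continuum law of the string observable `∏os` and `τ_K = ∑_m 2vol·δ_{K+m}` (the Cauchy tail of the remainders, `→ 0`), for every step `K` with
`τ_K ≤ 1` and every `Kg`-Lipschitz `g` with `|g| ≤ Gb` on `[−1,1]`: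
★★ `abs_integral_prodObs_sub_continuumLaw_le_logRate` — `|∫ g(∏os) dgibbs_K − ∫ g dν| ≤ 384·c(l₀)·(Kg+Gb)·log(e+L_K)∕(1+L_K)`, `L_K = log⁺τ_K⁻¹`,
`c(l₀) = 6 + l₀ + log max(1, 4e∕l₀)`; ★ `boundedLipschitz_rate_of_target` (beyond the step where `τ_K ≤ 1`, uniformly over the test class) and
★ `exists_continuumLaw_rate_of_target` (assembled under `Target` alone).  By p553677 ∕ p555512 `law_price_two_sided` no better order than
`log(e+L_K)∕(1+L_K)` follows from window matching in general (with geometric remainders `δ_K ≍ θ^K`: `L_K ≍ K`, so `dist_BL ≲ log K∕K`).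
§1 records the `ε = 0`-tolerant form of p555512's bound (at `ε = 0` the rate factor is `1` and the bound is the trivial `2Gb`).

HONEST FRAMING (binding).  Bookkeeping; NO consumer in the DAG today (what g9's continuum law p504707 ∕ p505344 can carry, now with its rate).
Nothing of Bałaban's is instantiated; NE7 ∕ NE7b ∕ NE7c NOT PRINTED, NOT proved; `Target` is a HYPOTHESIS; N19 NOT discharged; count-neutral.
One finite `T⁴` programme at fixed `ε`; nothing continuum ∕ `ℝ⁴` ∕ OS ∕ mass-gap ∕ Clay.  0 `def` ∕ 0 `sorry`.
-/

noncomputable section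

open Set Filter Topology Real MeasureTheory ProbabilityTheory

namespace Summit.QuantumFields.YangMills.Theorems.BalabanUVNodesN19LawPriceAtSchemeRate

open Literature.MathematicalPhysics.QuantumFieldTheory.Balaban1983to89
open T4CauchySum (MatchingModConstants genFun genFunLim abs_genFun_sub_lim_le)
open T4GenFunBounds (schemeZ prodObs gibbsMeasure)
open Missing (TorusScheme)
open Summit.QuantumFields.BalabanUV.T4Continuum.Spine
open Summit.QuantumFields.YangMills.BalabanUVNodes.N19ExpectationCurrencyAtScheme (mul_nonneg_of_matchingModConstants)
open Summit.QuantumFields.YangMills.BalabanUVNodes.N19ContinuumLawAtScheme (genFunLim_eq_cgf_of_continuumLaw continuumLaw_of_target)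
open Summit.QuantumFields.YangMills.Theorems.BalabanUVNodesN19LawPriceAtScheme (map_prodObs_Icc_compl cgf_map_prodObs)
open Summit.QuantumFields.YangMills.Theorems.BalabanUVNodesN19LawPriceJackson (integrable_of_continuous_Icc_symm)
open Summit.QuantumFields.YangMills.Theorems.BalabanUVNodesN19LawPriceTwoSided (law_price_le_logRate abs_integral_le_of_Icc_symm)

/-! ## §1 The `ε = 0`-tolerant form of the law-level price -/

section Laws

variable {μ ν : Measure ℝ} [IsProbabilityMeasure μ] [IsProbabilityMeasure ν]

/-- p555512 `law_price_le_logRate` for `0 ≤ ε ≤ 1` (at `ε = 0`, `log⁺0⁻¹ = 0`, the rate factor is `log e = 1` and the bound `384c(K+G)` dominates the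
trivial `2G`). [folklore] -/
theorem law_price_le_logRate_of_nonneg (hμ : μ (Icc (-1) 1)ᶜ = 0) (hν : ν (Icc (-1) 1)ᶜ = 0) {ε l₀ : ℝ} (hl₀ : 0 < l₀)
    (hε : 0 ≤ ε) (hε1 : ε ≤ 1) (hclose : ∀ t : ℝ, |t| ≤ l₀ → |cgf id ν t - cgf id μ t| ≤ ε)
    {g : ℝ → ℝ} {K : NNReal} (hg : LipschitzWith K g) {G : ℝ} (hG : ∀ x ∈ Icc (-1 : ℝ) 1, |g x| ≤ G) :
    |∫ x, g x ∂ν - ∫ x, g x ∂μ| ≤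
      384 * (6 + l₀ + Real.log (max 1 (4 * Real.exp 1 / l₀))) * (K + G) *
        (Real.log (Real.exp 1 + Real.posLog ε⁻¹) / (1 + Real.posLog ε⁻¹)) := by
  rcases eq_or_lt_of_le hε with h | h
  · -- `ε = 0`
    rw [← h, inv_zero, Real.posLog_zero, add_zero, add_zero, Real.log_exp, div_one, mul_one]
    have hG0 : 0 ≤ G := (abs_nonneg _).trans (hG 0 (by norm_num))
    have hK0 : (0 : ℝ) ≤ K := K.2
    have hc6 : 6 ≤ 6 + l₀ + Real.log (max 1 (4 * Real.exp 1 / l₀)) := by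
      have := Real.log_nonneg (le_max_left 1 (4 * Real.exp 1 / l₀)); linarith
    calc |∫ x, g x ∂ν - ∫ x, g x ∂μ| ≤ |∫ x, g x ∂ν| + |∫ x, g x ∂μ| := abs_sub _ _
      _ ≤ G + G := add_le_add (abs_integral_le_of_Icc_symm hν hG) (abs_integral_le_of_Icc_symm hμ hG)
      _ ≤ 384 * (6 + l₀ + Real.log (max 1 (4 * Real.exp 1 / l₀))) * (K + G) := by nlinarith
  · exact law_price_le_logRate hμ hν hl₀ h hε1 hclose hg hG

/-- **★ THE KANTOROVICH (W₁-DUAL) FORM: no sup-norm bound needed.**  For laws on `[−1,1]` the test function may be recentred (`g ↦ g − g(0)` changes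
neither integral difference, and `|g − g(0)| ≤ K` on `[−1,1]` for `K`-Lipschitz `g`): for `0 ≤ ε ≤ 1`, cgf's `ε`-close on `|t| ≤ l₀`, and EVERY
`K`-Lipschitz `g`, `|∫ g dν − ∫ g dμ| ≤ 768·c(l₀)·K·log(e+L)∕(1+L)` — i.e. the Wasserstein-1 distance (Kantorovich–Rubinstein dual over `1`-Lipschitz
`g`) of the two laws is `≤ 768·c(l₀)·log(e+L)∕(1+L)`, stated without a Wasserstein API. [folklore] -/
theorem law_price_le_logRate_lipschitz (hμ : μ (Icc (-1) 1)ᶜ = 0) (hν : ν (Icc (-1) 1)ᶜ = 0) {ε l₀ : ℝ} (hl₀ : 0 < l₀)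
    (hε : 0 ≤ ε) (hε1 : ε ≤ 1) (hclose : ∀ t : ℝ, |t| ≤ l₀ → |cgf id ν t - cgf id μ t| ≤ ε)
    {g : ℝ → ℝ} {K : NNReal} (hg : LipschitzWith K g) :
    |∫ x, g x ∂ν - ∫ x, g x ∂μ| ≤
      768 * (6 + l₀ + Real.log (max 1 (4 * Real.exp 1 / l₀))) * K *
        (Real.log (Real.exp 1 + Real.posLog ε⁻¹) / (1 + Real.posLog ε⁻¹)) := by
  -- recentre
  have hg' : LipschitzWith K (fun x => g x - g 0) := LipschitzWith.of_dist_le_mul fun x y => by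
    rw [Real.dist_eq, show g x - g 0 - (g y - g 0) = g x - g y by ring, ← Real.dist_eq]
    exact hg.dist_le_mul x y
  have hG' : ∀ x ∈ Icc (-1 : ℝ) 1, |g x - g 0| ≤ K := fun x hx => by
    have h := hg.dist_le_mul x 0
    rw [Real.dist_eq, Real.dist_eq, sub_zero] at h
    exact h.trans (by have : |x| ≤ 1 := abs_le.2 ⟨hx.1, hx.2⟩; nlinarith [K.2])
  have h := law_price_le_logRate_of_nonneg hμ hν hl₀ hε hε1 hclose hg' hG'
  have hgi : ∀ (κ : Measure ℝ) [IsProbabilityMeasure κ], κ (Icc (-1) 1)ᶜ = 0 →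
      ∫ x, (g x - g 0) ∂κ = ∫ x, g x ∂κ - g 0 := by
    intro κ _ hκ
    rw [integral_sub (integrable_of_continuous_Icc_symm hκ hg.continuous) (integrable_const _),
      integral_const, probReal_univ, one_smul]
  rw [hgi ν hν, hgi μ hμ, show ∫ x, g x ∂ν - g 0 - (∫ x, g x ∂μ - g 0) = ∫ x, g x ∂ν - ∫ x, g x ∂μ by ring] at h
  refine h.trans (le_of_eq ?_)
  ring

end Laws

/-! ## §2 At the scheme under `Spine.NE7.Target`: the continuum law at the rate `log(e+L_K)∕(1+L_K)` -/

section Scheme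

variable {G : Type*} [GaugeGroup G] [MeasurableSpace G] [RegularGaugeGroup G] [HaarData G] {O : Type*}
  (S : TorusScheme G O) (hβ : ∀ K, 0 ≤ S.β K) (hm : ∀ K o, Measurable (S.obs K o))
  (h1 : ∀ K o U, |S.obs K o U| ≤ 1)
include hβ hm h1

/-- **★★ g9's CONTINUUM LAW CONVERGES AT THE RATE `log(e+L_K)∕(1+L_K)`.**  Under N19's DECL target `Spine.NE7.Target vol l₀ δ (schemeZ S os)` on a
window `0 < l₀` (a HYPOTHESIS), let `ν` be a continuum law of `∏os` (p505344: `∫ f(∏os) dgibbs_K → ∫ f dν` for continuous `f`; `ν` on `[−1,1]`).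
Then for every step `K` whose Cauchy tail `τ_K = ∑_m 2vol·δ_{K+m}` is `≤ 1`, and every `Kg`-Lipschitz `g` with `|g| ≤ Gb` on `[−1,1]`:
`|∫ g(∏os) dgibbs_K − ∫ g dν| ≤ 384·c(l₀)·(Kg+Gb)·log(e+L_K)∕(1+L_K)`, `L_K = log⁺τ_K⁻¹`, `c(l₀) = 6 + l₀ + log max(1,4e∕l₀)` — the laws of `∏os`
under `gibbs_K` and `ν` have cgf's `τ_K`-close on the window (`cgf = genFun_K` by p551618 `cgf_map_prodObs`, `cgf_ν = genFunLim` by p505344, tail bound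
`T4CauchySum.abs_genFun_sub_lim_le`), and p555512 prices laws on `[−1,1]` on the Jackson road.  p551618's «∀η ∃K₀» made a RATE; sharp in order by
p555512 `law_price_two_sided`. [bookkeeping] -/
theorem abs_integral_prodObs_sub_continuumLaw_le_logRate {vol l₀ : ℝ} {δ : ℕ → ℝ} (hl₀ : 0 < l₀) (os : List O)
    (hT : NE7.Target vol l₀ δ (schemeZ S os)) (ν : Measure ℝ) [IsProbabilityMeasure ν] (hν1 : ν (Icc (-1) 1)ᶜ = 0)
    (hν : ∀ f : ℝ → ℝ, Continuous f →
      Tendsto (fun K => ∫ U, f (prodObs S K os U) ∂gibbsMeasure (S.P K) (S.β K)) atTop (𝓝 (∫ x, f x ∂ν)))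
    {g : ℝ → ℝ} {Kg : NNReal} (hg : LipschitzWith Kg g) {Gb : ℝ} (hG : ∀ x ∈ Icc (-1 : ℝ) 1, |g x| ≤ Gb) (K : ℕ)
    (hτ1 : ∑' m, 2 * (vol * δ (K + m)) ≤ 1) :
    |∫ U, g (prodObs S K os U) ∂gibbsMeasure (S.P K) (S.β K) - ∫ x, g x ∂ν| ≤
      384 * (6 + l₀ + Real.log (max 1 (4 * Real.exp 1 / l₀))) * (Kg + Gb) *
        (Real.log (Real.exp 1 + Real.posLog (∑' m, 2 * (vol * δ (K + m)))⁻¹) /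
          (1 + Real.posLog (∑' m, 2 * (vol * δ (K + m)))⁻¹)) := by
  obtain ⟨hM, hδ⟩ := hT
  haveI hP : IsProbabilityMeasure (gibbsMeasure (G := G) (S.P K) (S.β K)) :=
    T4GenFunBounds.isProbabilityMeasure_gibbsMeasure (G := G) (S.P K) (hβ K)
  set μK : Measure ℝ := (gibbsMeasure (S.P K) (S.β K)).map (prodObs S K os) with hμK
  haveI : IsProbabilityMeasure μK := Measure.isProbabilityMeasure_map (T4GenFunBounds.measurable_prodObs S hm K os).aemeasurable
  have hτ0 : 0 ≤ ∑' m, 2 * (vol * δ (K + m)) :=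
    tsum_nonneg fun m => mul_nonneg two_pos.le (mul_nonneg_of_matchingModConstants hl₀.le hM (K + m))
  -- cgf's of `μK` and `ν` are `τ_K`-close on the window
  have hclose : ∀ t : ℝ, |t| ≤ l₀ → |cgf id ν t - cgf id μK t| ≤ ∑' m, 2 * (vol * δ (K + m)) := fun t ht => by
    rw [hμK, cgf_map_prodObs S hβ hm h1 K os t, ← (genFunLim_eq_cgf_of_continuumLaw S hβ hm h1 os ν hν t).2, abs_sub_comm]
    exact abs_genFun_sub_lim_le hM hl₀.le hδ ht K
  have h := law_price_le_logRate_of_nonneg (μ := μK) (ν := ν) (map_prodObs_Icc_compl S hm h1 K os) hν1 hl₀ hτ0 hτ1 hclose hg hG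
  rw [hμK, integral_map (T4GenFunBounds.measurable_prodObs S hm K os).aemeasurable hg.continuous.aestronglyMeasurable, abs_sub_comm] at h
  exact h

/-- **★ … UNIFORMLY OVER THE TEST CLASS, BEYOND THE STEP WHERE `τ_K ≤ 1`.**  Under `Target` on `0 < l₀`, with the continuum law `ν` of `∏os`: there
is `K₀` such that for every `K ≥ K₀` and EVERY `Kg`-Lipschitz `g` with `|g| ≤ Gb` on `[−1,1]`,
`|∫ g(∏os) dgibbs_K − ∫ g dν| ≤ 384·c(l₀)·(Kg+Gb)·log(e+L_K)∕(1+L_K)` (`τ_K → 0` by Mathlib `tendsto_sum_nat_add`).  p551618's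
`boundedLipschitz_convergence_of_target` with its rate. [bookkeeping] -/
theorem boundedLipschitz_rate_of_target {vol l₀ : ℝ} {δ : ℕ → ℝ} (hl₀ : 0 < l₀) (os : List O)
    (hT : NE7.Target vol l₀ δ (schemeZ S os)) (ν : Measure ℝ) [IsProbabilityMeasure ν] (hν1 : ν (Icc (-1) 1)ᶜ = 0)
    (hν : ∀ f : ℝ → ℝ, Continuous f →
      Tendsto (fun K => ∫ U, f (prodObs S K os U) ∂gibbsMeasure (S.P K) (S.β K)) atTop (𝓝 (∫ x, f x ∂ν))) :
    ∃ K₀ : ℕ, ∀ K, K₀ ≤ K → ∀ (g : ℝ → ℝ) (Kg : NNReal) (Gb : ℝ), LipschitzWith Kg g → (∀ x ∈ Icc (-1 : ℝ) 1, |g x| ≤ Gb) →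
      |∫ U, g (prodObs S K os U) ∂gibbsMeasure (S.P K) (S.β K) - ∫ x, g x ∂ν| ≤
        384 * (6 + l₀ + Real.log (max 1 (4 * Real.exp 1 / l₀))) * (Kg + Gb) *
          (Real.log (Real.exp 1 + Real.posLog (∑' m, 2 * (vol * δ (K + m)))⁻¹) /
            (1 + Real.posLog (∑' m, 2 * (vol * δ (K + m)))⁻¹)) := by
  have hτlim : Tendsto (fun K => ∑' m, 2 * (vol * δ (K + m))) atTop (𝓝 0) := by
    have h := tendsto_sum_nat_add fun j => 2 * (vol * δ j)
    exact h.congr fun i => tsum_congr fun k => by rw [add_comm]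
  obtain ⟨K₀, hK₀⟩ := (hτlim.eventually (ge_mem_nhds one_pos)).exists_forall_of_atTop
  exact ⟨K₀, fun K hK g Kg Gb hg hG =>
    abs_integral_prodObs_sub_continuumLaw_le_logRate S hβ hm h1 hl₀ os hT ν hν1 hν hg hG K (hK₀ K hK)⟩

/-- **★ ASSEMBLED UNDER `Target` ALONE** (the continuum law supplied by p505344's `continuumLaw_of_target`): under `Spine.NE7.Target vol l₀ δ (schemeZ S os)`,
`0 < l₀`, there is a probability law `ν` on `[−1,1]`, the weak limit of the laws of `∏os`, approached in the bounded-Lipschitz sense at the rate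
`384·c(l₀)·(Kg+Gb)·log(e+L_K)∕(1+L_K)` beyond some step. [bookkeeping] -/
theorem exists_continuumLaw_rate_of_target {vol l₀ : ℝ} {δ : ℕ → ℝ} (hl₀ : 0 < l₀) (os : List O)
    (hT : NE7.Target vol l₀ δ (schemeZ S os)) :
    ∃ ν : Measure ℝ, IsProbabilityMeasure ν ∧ ν (Icc (-1) 1)ᶜ = 0 ∧
      (∀ f : ℝ → ℝ, Continuous f →
        Tendsto (fun K => ∫ U, f (prodObs S K os U) ∂gibbsMeasure (S.P K) (S.β K)) atTop (𝓝 (∫ x, f x ∂ν))) ∧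
      ∃ K₀ : ℕ, ∀ K, K₀ ≤ K → ∀ (g : ℝ → ℝ) (Kg : NNReal) (Gb : ℝ), LipschitzWith Kg g → (∀ x ∈ Icc (-1 : ℝ) 1, |g x| ≤ Gb) →
        |∫ U, g (prodObs S K os U) ∂gibbsMeasure (S.P K) (S.β K) - ∫ x, g x ∂ν| ≤
          384 * (6 + l₀ + Real.log (max 1 (4 * Real.exp 1 / l₀))) * (Kg + Gb) *
            (Real.log (Real.exp 1 + Real.posLog (∑' m, 2 * (vol * δ (K + m)))⁻¹) /
              (1 + Real.posLog (∑' m, 2 * (vol * δ (K + m)))⁻¹)) := by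
  obtain ⟨ν, iν, hν1, hν, -⟩ := continuumLaw_of_target S hβ hm h1 hl₀ os hT
  exact ⟨ν, iν, hν1, hν, boundedLipschitz_rate_of_target S hβ hm h1 hl₀ os hT ν hν1 hν⟩

end Scheme

end Summit.QuantumFields.YangMills.Theorems.BalabanUVNodesN19LawPriceAtSchemeRate

end
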